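import Literature.Analysis.FluidPDE.FluidComputer.ThresholdLevelStep
import Literature.Analysis.FluidPDE.FluidComputer.ThresholdLevelChain
import Literature.Analysis.FluidPDE.Tao2016AveragedNS.SeedScaleIgnition
import Literature.NumberTheory.LFunctions.NumHelpers
import HarnessLib

/-!
# Fluid computer blueprint — threshold gate: EXIT BOX of the level step and the LEVEL TABLE stage

HONEST FRAMING: low prior, high value-of-information experiment on Tao's machine paradigm; NOT a
claim that NS blows up. Elementary interval bookkeeping for the 5-mode circuit
`thresholdCircuit ε σ ν μ r κ` on a forced window; nothing is asserted about any fluid equation.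

## What this file is (bp3 gen 12)

* `LevelEntry.exitBox`: the entry box AT THE NEXT LEVEL `c = C'` computed from the entry box at
  level `C`, the final window box `S` and the hitting-time bracket
  `t* ∈ [(C' - C)/ρh, min ((C' - C)/ρℓ) h]` (envelopes at the two endpoints, the conduit box
  from the residual, the energy band widened by `10 δ Rb h`, and the energy squeeze of the output
  and carrier boxes) — the `exit` block of `bookkeep_v6.step_w`;
* `IsForcedWindow.exit_mem`: at the hitting time the state lies in `exitBox`;
* `IsForcedWindow.level_step`: the level step in the composition-ready shape consumed by
  `IsForcedWindow.level_chain` / `levelTransferStage` (`ThresholdLevelChain`);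
* `levelTableStage`: a `ReachCertificate` of the transfer stage from a finite LEVEL TABLE
  (levels `C k`, boxes `B k`, step caps `h k`, pass counts `K k`) whose rows satisfy the
  numerical side conditions — the object a rational table instance (gen 13) has to inhabit.

[cite: Tao2016AveragedNS, §5.5 Thm 5.3 (5.5)] for the circuit; everything here is [folklore].
-/

noncomputable section

open Set Filter Topology
open scoped NNReal

namespace Literature.Analysis.FluidPDE.FluidComputer

open Literature.Analysis.FluidPDE.Tao2016AveragedNS Literature.Analysis.ODE

namespace LevelEntry

variable (G : GateData) (B : LevelEntry) (S : WindowBox) (Rb h C C' : ℝ)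

/-- **The exit box at level `C'`** (the `exit` block of `bookkeep_v6.step_w`). [folklore] -/
def exitBox : LevelEntry :=
  let tlo := (C' - C) / S.ρh G
  let thi := min ((C' - C) / S.ρℓ G) h
  let a_l := min (S.aFloor G B.al tlo) (S.aFloor G B.al thi)
  let a_h := max (S.aCeil G B.ah tlo) (S.aCeil G B.ah thi)
  let b_l := min (B.bl + S.βℓ G * tlo) (B.bl + S.βℓ G * thi)
  let b_h := max (B.bh + S.βh G * tlo) (B.bh + S.βh G * thi)
  let w_l := min (S.wFloor G B.wl tlo) (S.wFloor G B.wl thi)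
  let w_h := max (S.wCeil G B.wh tlo) (S.wCeil G B.wh thi)
  let z_l := max S.Zℓ (min (B.zl + S.ζℓ G * tlo) (B.zl + S.ζℓ G * thi))
  let z_h := max (B.zh + S.ζh G * tlo) (B.zh + S.ζh G * thi)
  let d_l := max 0 ((w_l + G.r * C' * max a_l 0) / (G.κ * z_h))
  let d_h := (w_h + G.r * C' * a_h) / (G.κ * z_l)
  let El' := B.El - 10 * (G.δ * Rb) * h
  let Eh' := B.Eh + 10 * (G.δ * Rb) * h
  let bmax2 := max |b_l| |b_h| ^ 2
  let bmin2 := max b_l 0 ^ 2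
  let z_l' := max z_l (Real.sqrt (El' - a_h ^ 2 - bmax2 - C' ^ 2 - d_h ^ 2))
  let z_h' := min z_h (Real.sqrt (Eh' - max a_l 0 ^ 2 - bmin2 - C' ^ 2 - d_l ^ 2))
  let a_h' := min a_h (Real.sqrt (Eh' - bmin2 - C' ^ 2 - z_l' ^ 2 - d_l ^ 2))
  let a_l' := max a_l (Real.sqrt (El' - bmax2 - C' ^ 2 - z_h' ^ 2 - d_h ^ 2))
  { al := a_l', ah := a_h', bl := b_l, bh := b_h, wl := w_l, wh := w_h, zl := z_l', zh := z_h',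
    El := El', Eh := Eh' }

end LevelEntry

/-! ### Elementary squeeze lemmas -/

/-- `b² ≤ (max |bₗ| |bₕ|)²` for `bₗ ≤ b ≤ bₕ`. [folklore] -/
theorem sq_le_max_abs_sq {b bl bh : ℝ} (h1 : bl ≤ b) (h2 : b ≤ bh) :
    b ^ 2 ≤ max |bl| |bh| ^ 2 := by
  have hb : |b| ≤ max |bl| |bh| := abs_le_max_abs_abs h1 h2
  have := pow_le_pow_left₀ (abs_nonneg b) hb 2
  simpa only [sq_abs] using this

/-- `(max bₗ 0)² ≤ b²` for `bₗ ≤ b`. [folklore] -/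
theorem max_zero_sq_le_sq {b bl : ℝ} (h1 : bl ≤ b) : max bl 0 ^ 2 ≤ b ^ 2 := by
  have hb : max bl 0 ≤ |b| := max_le (h1.trans (le_abs_self b)) (abs_nonneg b)
  have := pow_le_pow_left₀ (le_max_right _ _) hb 2
  simpa only [sq_abs] using this

namespace IsForcedWindow

variable {G : GateData} {x : ℝ → Fin 5 → ℝ}

/-- **EXIT MEMBERSHIP.** At the hitting time `T` of level `C'` (with `T` in the bracket
`[(C' - C)/ρh, min ((C' - C)/ρℓ) h]`, the final box `S` valid on `[0, T]`, the ball bound on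
`[0, T)` and the entry box at time `0`), the state lies in the exit box. [folklore] -/
theorem exit_mem (hG : G.Valid) {h C C' Rb T : ℝ} {B : LevelEntry} {S : WindowBox}
    (hW : IsForcedWindow G.ε G.σ G.ν G.μ G.r G.κ G.δ T x) (hT0 : 0 ≤ T) (hTh : T ≤ h)
    (hRb : 0 ≤ Rb) (hball : ∀ t ∈ Ico 0 T, ∀ i, |x t i| ≤ Rb) (hB : B.mem G.κ G.r C (x 0))
    (hS : ∀ t ∈ Icc 0 T, S.mem G.κ G.r (x t)) (hside : S.Sides G) (hcT : x T 2 = C')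
    (hlo : (C' - C) / S.ρh G ≤ T) (hhi : T ≤ min ((C' - C) / S.ρℓ G) h) :
    (B.exitBox G S Rb h C C').mem G.κ G.r C' (x T) := by
  have henv := hW.envelope_bounds hG hS hside hB T ⟨hT0, le_rfl⟩
  obtain ⟨hε, hσ, hν, hμ, hr, hκ, hδ⟩ := hG
  obtain ⟨hA0, -, hc0, hD0, hZ0, -, -⟩ := hside
  obtain ⟨⟨haF, haC⟩, ⟨hbF, hbC⟩, -, ⟨hzF, hzC⟩, ⟨hwF, hwC⟩⟩ := henv
  obtain ⟨⟨haℓT, -⟩, -, ⟨hcℓT, -⟩, ⟨hdℓT, -⟩, ⟨hzℓT, -⟩, -⟩ := hS T ⟨hT0, le_rfl⟩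
  obtain ⟨-, -, -, -, -, ⟨hEl, hEh⟩⟩ := hB
  have hTI : T ∈ Icc ((C' - C) / S.ρh G) (min ((C' - C) / S.ρℓ G) h) := ⟨hlo, hhi⟩
  -- abbreviations (kept opaque through equations)
  set tlo := (C' - C) / S.ρh G with htlo
  set thi := min ((C' - C) / S.ρℓ G) h with hthi
  -- raw envelope boxes at the exit time
  have ha_l : min (S.aFloor G B.al tlo) (S.aFloor G B.al thi) ≤ x T 0 := by
    simp only [WindowBox.aFloor] at haF ⊢
    exact (min_neg_gronwallBound_le _ _ _ hTI).trans haF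
  have ha_h : x T 0 ≤ max (S.aCeil G B.ah tlo) (S.aCeil G B.ah thi) := by
    simp only [WindowBox.aCeil] at haC ⊢
    exact haC.trans (gronwallBound_mem_endpoints B.ah (-S.Λℓ G) (S.mh G) hTI).2
  have hb_l : min (B.bl + S.βℓ G * tlo) (B.bl + S.βℓ G * thi) ≤ x T 1 :=
    (affine_mem_endpoints B.bl (S.βℓ G) hTI).1.trans hbF
  have hb_h : x T 1 ≤ max (B.bh + S.βh G * tlo) (B.bh + S.βh G * thi) :=
    hbC.trans (affine_mem_endpoints B.bh (S.βh G) hTI).2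
  have hw_l : min (S.wFloor G B.wl tlo) (S.wFloor G B.wl thi) ≤ slavingResidual G.κ G.r (x T) := by
    simp only [WindowBox.wFloor] at hwF ⊢
    exact (min_neg_gronwallBound_le _ _ _ hTI).trans hwF
  have hw_h : slavingResidual G.κ G.r (x T) ≤ max (S.wCeil G B.wh tlo) (S.wCeil G B.wh thi) := by
    simp only [WindowBox.wCeil] at hwC ⊢
    exact hwC.trans (gronwallBound_mem_endpoints B.wh (-(G.κ * S.Zℓ)) (S.sh G) hTI).2
  have hz_l : max S.Zℓ (min (B.zl + S.ζℓ G * tlo) (B.zl + S.ζℓ G * thi)) ≤ x T 4 :=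
    max_le hzℓT ((affine_mem_endpoints B.zl (S.ζℓ G) hTI).1.trans hzF)
  have hz_h : x T 4 ≤ max (B.zh + S.ζh G * tlo) (B.zh + S.ζh G * thi) :=
    hzC.trans (affine_mem_endpoints B.zh (S.ζh G) hTI).2
  -- name the raw box
  set a_l := min (S.aFloor G B.al tlo) (S.aFloor G B.al thi) with ha_l_def
  set a_h := max (S.aCeil G B.ah tlo) (S.aCeil G B.ah thi) with ha_h_def
  set b_l := min (B.bl + S.βℓ G * tlo) (B.bl + S.βℓ G * thi) with hb_l_def
  set b_h := max (B.bh + S.βh G * tlo) (B.bh + S.βh G * thi) with hb_h_def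
  set w_l := min (S.wFloor G B.wl tlo) (S.wFloor G B.wl thi) with hw_l_def
  set w_h := max (S.wCeil G B.wh tlo) (S.wCeil G B.wh thi) with hw_h_def
  set z_l := max S.Zℓ (min (B.zl + S.ζℓ G * tlo) (B.zl + S.ζℓ G * thi)) with hz_l_def
  set z_h := max (B.zh + S.ζh G * tlo) (B.zh + S.ζh G * thi) with hz_h_def
  -- signs at the exit time
  have ha0 : 0 ≤ x T 0 := hA0.trans haℓT
  have hd0 : 0 ≤ x T 3 := hD0.trans hdℓT
  have hz0 : 0 < x T 4 := hZ0.trans_le hzℓT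
  have hC' : 0 ≤ C' := by rw [← hcT]; exact hc0.trans hcℓT
  have hzl0 : 0 < z_l := hZ0.trans_le (le_max_left _ _)
  -- conduit box at the exit time
  have ha' : max a_l 0 ≤ x T 0 ∧ x T 0 ≤ a_h := ⟨max_le ha_l ha0, ha_h⟩
  have hc' : C' ≤ x T 2 ∧ x T 2 ≤ C' := ⟨hcT.symm.le, hcT.le⟩
  have hdd := conduit_mem_of_boxes hr hκ (le_max_right a_l 0) hC' hzl0 le_rfl ha' hc'
    ⟨hz_l, hz_h⟩ ⟨hw_l, hw_h⟩ hd0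
  set d_l := max 0 ((w_l + G.r * C' * max a_l 0) / (G.κ * z_h)) with hd_l_def
  set d_h := (w_h + G.r * C' * a_h) / (G.κ * z_l) with hd_h_def
  have hdl0 : 0 ≤ d_l := le_max_left _ _
  -- energy band
  have hEabs := hW.energy_abs_sub_le hRb hball T ⟨hT0, le_rfl⟩
  have hδRb : 0 ≤ 10 * (G.δ * Rb) := by positivity
  have hEband : B.El - 10 * (G.δ * Rb) * h ≤ energy (x T) ∧
      energy (x T) ≤ B.Eh + 10 * (G.δ * Rb) * h := by
    have h1 := (abs_le.1 hEabs)
    have h2 := mul_le_mul_of_nonneg_left hTh hδRb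
    constructor <;> linarith [h1.1, h1.2]
  set El' := B.El - 10 * (G.δ * Rb) * h with hEl'
  set Eh' := B.Eh + 10 * (G.δ * Rb) * h with hEh'
  -- squares
  have hEx := Ignition.energy_five (x T)
  rw [hcT] at hEx
  have hb2h : x T 1 ^ 2 ≤ max |b_l| |b_h| ^ 2 := sq_le_max_abs_sq hb_l hb_h
  have hb2l : max b_l 0 ^ 2 ≤ x T 1 ^ 2 := max_zero_sq_le_sq hb_l
  set bmax2 := max |b_l| |b_h| ^ 2 with hbmax2
  set bmin2 := max b_l 0 ^ 2 with hbmin2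
  have ha2h : x T 0 ^ 2 ≤ a_h ^ 2 := pow_le_pow_left₀ ha0 ha_h 2
  have ha2l : max a_l 0 ^ 2 ≤ x T 0 ^ 2 := pow_le_pow_left₀ (le_max_right _ _) ha'.1 2
  have hd2h : x T 3 ^ 2 ≤ d_h ^ 2 := pow_le_pow_left₀ hd0 hdd.2 2
  have hd2l : d_l ^ 2 ≤ x T 3 ^ 2 := pow_le_pow_left₀ hdl0 hdd.1 2
  -- output floor squeeze
  set z_l' := max z_l (Real.sqrt (El' - a_h ^ 2 - bmax2 - C' ^ 2 - d_h ^ 2)) with hz_l'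
  have hzl' : z_l' ≤ x T 4 := by
    refine max_le hz_l (Literature.NumberTheory.LFunctions.VdC.Num.sqrt_le_of_le_sq hz0.le ?_)
    linarith [hEband.1]
  have hzl'0 : 0 ≤ z_l' := hzl0.le.trans (le_max_left _ _)
  have hz2l : z_l' ^ 2 ≤ x T 4 ^ 2 := pow_le_pow_left₀ hzl'0 hzl' 2
  -- output ceiling squeeze
  set z_h' := min z_h (Real.sqrt (Eh' - max a_l 0 ^ 2 - bmin2 - C' ^ 2 - d_l ^ 2)) with hz_h'
  have hzh' : x T 4 ≤ z_h' := by
    refine le_min hz_h (Literature.NumberTheory.LFunctions.VdC.Num.le_sqrt_of_sq_le hz0.le ?_)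
    linarith [hEband.2]
  have hz2h : x T 4 ^ 2 ≤ z_h' ^ 2 := pow_le_pow_left₀ hz0.le hzh' 2
  -- carrier ceiling squeeze
  set a_h' := min a_h (Real.sqrt (Eh' - bmin2 - C' ^ 2 - z_l' ^ 2 - d_l ^ 2)) with ha_h'
  have hah' : x T 0 ≤ a_h' := by
    refine le_min ha_h (Literature.NumberTheory.LFunctions.VdC.Num.le_sqrt_of_sq_le ha0 ?_)
    linarith [hEband.2]
  -- carrier floor squeeze
  set a_l' := max a_l (Real.sqrt (El' - bmax2 - C' ^ 2 - z_h' ^ 2 - d_h ^ 2)) with ha_l'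
  have hal' : a_l' ≤ x T 0 := by
    refine max_le ha_l (Literature.NumberTheory.LFunctions.VdC.Num.sqrt_le_of_le_sq ha0 ?_)
    linarith [hEband.1]
  -- assemble
  refine ⟨⟨hal', hah'⟩, ⟨hb_l, hb_h⟩, hcT, ⟨hw_l, hw_h⟩, ⟨hzl', hzh'⟩, hEband⟩

/-- **ONE LEVEL STEP along a pass chain** = `level_window_chain` + `exit_mem`: the implication
consumed by `IsForcedWindow.level_chain`, with entry set `B.mem … C` and exit set
`(B.exitBox G (S K) Rb h C C').mem … C'`. [folklore] -/
theorem level_step_chain (hG : G.Valid) {h C C' Rb : ℝ} {B : LevelEntry} {K : ℕ}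
    {S : ℕ → WindowBox} (hh : 0 ≤ h) (hRb : 0 ≤ Rb) (hcs : B.CrudeSides G Rb h C C')
    (hchain : B.PassChain G Rb h C C' K S) (hsides : ∀ j ≤ K, (S j).Sides G)
    (hreach : C' - C ≤ (S K).ρℓ G * h) (hρ : 0 < (S K).ρℓ G) :
    ∀ y : ℝ → Fin 5 → ℝ, IsForcedWindow G.ε G.σ G.ν G.μ G.r G.κ G.δ h y →
      (∀ t ∈ Ico 0 h, ∀ i, |y t i| < Rb) → B.mem G.κ G.r C (y 0) →
        ∃ t ∈ Icc 0 h, (B.exitBox G (S K) Rb h C C').mem G.κ G.r C' (y t) := by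
  intro y hW hball hB
  obtain ⟨T, hTmem, hlo, hhi, hcT, hballT, -, hSK⟩ :=
    hW.level_window_chain hG hh hRb hball hB hcs hchain hsides hreach hρ
  exact ⟨T, hTmem, (hW.mono hTmem.2).exit_mem hG hTmem.1 hTmem.2 hRb hballT hB hSK
    (hsides K le_rfl) hcT hlo hhi⟩

/-- **ONE LEVEL STEP** for the exact recursion `levelBox`. [folklore] -/
theorem level_step (hG : G.Valid) {h C C' Rb : ℝ} {B : LevelEntry} {K : ℕ} (hh : 0 ≤ h)
    (hRb : 0 ≤ Rb) (hcs : B.CrudeSides G Rb h C C')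
    (hsides : ∀ j ≤ K, (B.levelBox G Rb h C C' j).Sides G)
    (hreach : C' - C ≤ (B.levelBox G Rb h C C' K).ρℓ G * h)
    (hρ : 0 < (B.levelBox G Rb h C C' K).ρℓ G) :
    ∀ y : ℝ → Fin 5 → ℝ, IsForcedWindow G.ε G.σ G.ν G.μ G.r G.κ G.δ h y →
      (∀ t ∈ Ico 0 h, ∀ i, |y t i| < Rb) → B.mem G.κ G.r C (y 0) →
        ∃ t ∈ Icc 0 h, (B.exitBox G (B.levelBox G Rb h C C' K) Rb h C C').mem G.κ G.r C' (y t) :=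
  level_step_chain hG hh hRb hcs (B.passChain_levelBox G Rb h C C' K) hsides hreach hρ

end IsForcedWindow

/-! ### The level-table transfer stage -/

/-- **A LEVEL TABLE** for the transfer stage: `N` levels `C 0 < C 1 < … < C N`, entry boxes
`B k`, step caps `h k`, pass counts `K k` and pass boxes `S k 0, …, S k (K k)` (for the exact
recursion take `S k := (B k).levelBox …`, see `RowsValid.of_exact`). [folklore] -/
structure LevelTable where
  /-- number of level steps -/
  N : ℕ
  /-- trigger levels -/
  C : ℕ → ℝ
  /-- entry boxes at the levels -/
  B : ℕ → LevelEntry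
  /-- time caps of the steps -/
  h : ℕ → ℝ
  /-- refinement pass counts -/
  K : ℕ → ℕ
  /-- pass boxes of the steps -/
  S : ℕ → ℕ → WindowBox

namespace LevelTable

/-- **Row conditions of a level table** (what a numerical instance has to check, row by row):
nonnegative caps; the crude side conditions; the pass boxes form a pass chain (`S k 0 ⊇ crudeBox`,
`S k (j+1) ⊇ refine (S k j)` — containments, so a rational table may round outward from certified
brackets of the exponentials) and satisfy the side conditions; the reach condition at the last
pass; and the box at level `k + 1` CONTAINS the exit box of step `k`. [folklore] -/
structure RowsValid (G : GateData) (Rb : ℝ) (L : LevelTable) : Prop where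
  hh : ∀ k, 0 ≤ L.h k
  crude : ∀ k < L.N, (L.B k).CrudeSides G Rb (L.h k) (L.C k) (L.C (k + 1))
  chain : ∀ k < L.N, (L.B k).PassChain G Rb (L.h k) (L.C k) (L.C (k + 1)) (L.K k) (L.S k)
  sides : ∀ k < L.N, ∀ j ≤ L.K k, (L.S k j).Sides G
  reach : ∀ k < L.N, L.C (k + 1) - L.C k ≤ (L.S k (L.K k)).ρℓ G * L.h k
  speed : ∀ k < L.N, 0 < (L.S k (L.K k)).ρℓ G
  next : ∀ k < L.N, ∀ X : Fin 5 → ℝ,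
    ((L.B k).exitBox G (L.S k (L.K k)) Rb (L.h k) (L.C k) (L.C (k + 1))).mem G.κ G.r
      (L.C (k + 1)) X → (L.B (k + 1)).mem G.κ G.r (L.C (k + 1)) X

/-- **Row conditions for the EXACT recursion** (`S k = levelBox`): it suffices to check the crude
side conditions, `Sides` on the crude box of every step (`LevelEntry.levelBox_sides`), reach and
speed at the last pass, and the exit containment. [folklore] -/
theorem RowsValid.of_exact {G : GateData} (hG : G.Valid) {Rb : ℝ} {L : LevelTable}
    (hS : ∀ k j, L.S k j = (L.B k).levelBox G Rb (L.h k) (L.C k) (L.C (k + 1)) j)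
    (hh : ∀ k, 0 ≤ L.h k)
    (crude : ∀ k < L.N, (L.B k).CrudeSides G Rb (L.h k) (L.C k) (L.C (k + 1)))
    (csides : ∀ k < L.N, ((L.B k).crudeBox G Rb (L.h k) (L.C k) (L.C (k + 1))).Sides G)
    (reach : ∀ k < L.N, L.C (k + 1) - L.C k ≤ (L.S k (L.K k)).ρℓ G * L.h k)
    (speed : ∀ k < L.N, 0 < (L.S k (L.K k)).ρℓ G)
    (next : ∀ k < L.N, ∀ X : Fin 5 → ℝ,
      ((L.B k).exitBox G (L.S k (L.K k)) Rb (L.h k) (L.C k) (L.C (k + 1))).mem G.κ G.r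
        (L.C (k + 1)) X → (L.B (k + 1)).mem G.κ G.r (L.C (k + 1)) X) :
    L.RowsValid G Rb := by
  have hSf : ∀ k, L.S k = (L.B k).levelBox G Rb (L.h k) (L.C k) (L.C (k + 1)) :=
    fun k => funext (hS k)
  refine ⟨hh, crude, fun k hk => ?_, fun k hk j _ => ?_, reach, speed, next⟩
  · rw [hSf k]; exact (L.B k).passChain_levelBox G Rb (L.h k) (L.C k) (L.C (k + 1)) (L.K k)
  · rw [hS k j]
    exact (L.B k).levelBox_sides hG Rb (L.h k) (L.C k) (L.C (k + 1)) (csides k hk) j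

end LevelTable

/-- **THE LEVEL-TABLE TRANSFER STAGE.** A level table with valid rows, total cap `∑ h k ≤ T₃`,
an input region inside the level-`0` box with energy margin `energy + 10 δ Rb T₃ < Rb²`, and a
final box forcing `E_out ≤ ã²`, gives a `ReachCertificate` of the transfer stage from `Ain` to
`outputLoaded E_out` within time `T₃` (`levelTransferStage` with `Box k := (B k).mem κ r (C k)`).
[cite: Tao2016AveragedNS, §5.5 Thm 5.3 (5.5)] -/
def levelTableStage (G : GateData) (hG : G.Valid) (Rb T₃ Eout : ℝ) (L : LevelTable)
    (Ain : Set (Fin 5 → ℝ)) (hRb : 0 ≤ Rb) (hrows : L.RowsValid G Rb)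
    (htime : ∑ k ∈ Finset.range L.N, L.h k ≤ T₃)
    (hE : ∀ p ∈ Ain, energy p + 10 * (G.δ * Rb) * T₃ < Rb ^ 2)
    (hin : ∀ p ∈ Ain, (L.B 0).mem G.κ G.r (L.C 0) p)
    (hexit : ∀ X, (L.B L.N).mem G.κ G.r (L.C L.N) X → Eout ≤ X 4 ^ 2) :
    ReachCertificate (thresholdCircuit G.ε G.σ G.ν G.μ G.r G.κ) (modeBall Rb) G.δ T₃ Ain
      (outputLoaded Eout) :=
  levelTransferStage G.ε G.σ G.ν G.μ G.r G.κ G.δ Rb T₃ Eout Ain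
    (fun k X => (L.B k).mem G.κ G.r (L.C k) X) L.h L.N hG.hκ.le hG.hδ hRb hrows.hh htime hE hin
    (fun k hk y hW hball hB => by
      obtain ⟨t, ht, hmem⟩ := IsForcedWindow.level_step_chain hG (hrows.hh k) hRb
        (hrows.crude k hk) (hrows.chain k hk) (hrows.sides k hk) (hrows.reach k hk)
        (hrows.speed k hk) y hW hball hB
      exact ⟨t, ht, hrows.next k hk _ hmem⟩)
    hexit

/-- **Reach form of the level-table stage**: every forced orbit from `Ain` loads the output to
`E_out` within time `T₃`. [cite: Tao2016AveragedNS, §5.5 Thm 5.3 (5.5)] -/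
theorem levelTableStage_reach (G : GateData) (hG : G.Valid) (Rb T₃ Eout : ℝ) (L : LevelTable)
    (Ain : Set (Fin 5 → ℝ)) (hRb : 0 ≤ Rb) (hrows : L.RowsValid G Rb)
    (htime : ∑ k ∈ Finset.range L.N, L.h k ≤ T₃) (hT₃ : 0 ≤ T₃)
    (hE : ∀ p ∈ Ain, energy p + 10 * (G.δ * Rb) * T₃ < Rb ^ 2)
    (hin : ∀ p ∈ Ain, (L.B 0).mem G.κ G.r (L.C 0) p)
    (hexit : ∀ X, (L.B L.N).mem G.κ G.r (L.C L.N) X → Eout ≤ X 4 ^ 2)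
    {p : Fin 5 → ℝ} (hp : p ∈ Ain) {x : ℝ → Fin 5 → ℝ} (hx0 : x 0 = p)
    (hcont : ContinuousOn x (Icc 0 T₃))
    (hder : ∀ s ∈ Ico 0 T₃, ∃ W : Fin 5 → ℝ, HasDerivWithinAt x W (Ici s) s ∧
      ‖W - thresholdCircuit G.ε G.σ G.ν G.μ G.r G.κ (x s)‖ ≤ G.δ) :
    ∃ s ∈ Icc 0 T₃, Eout ≤ x s 4 ^ 2 :=
  (levelTableStage G hG Rb T₃ Eout L Ain hRb hrows htime hE hin hexit).reach (isOpen_modeBall Rb)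
    hp hT₃ hx0 hcont hder

end Literature.Analysis.FluidPDE.FluidComputer

end
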